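import Literature.Probability.Percolation.ArmSeparationFourArm
import Literature.Probability.Percolation.ArmExponentsFourArmProofs
import Literature.Probability.Percolation.ArmSeparationNonvacuity
import HarnessLib

/-!
# Quasi-multiplicativity of the four-arm probability from four-arm separation (Nolin 2008, Prop. 12/17, `j = 4`)

Topic: Probability / Percolation; family `crit-perc`. The probabilistic half of the four-arm
gluing layer built in `ArmSeparationFourArm.lean`, serving the named fact
`Literature.Probability.Percolation.fourArm_exponent` (`ArmExponents.lean`; Smirnov–Werner 2001,
Thm. 4 for `j = 4`: `π₄(r₀, R) = R^{-5/4 + o(1)}`). `ArmExponentsFourArmProofs.lean` reduced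
`fourArm_exponent` to three inputs: (16)ℕ the integer-dilation scaling limits of `π₄`, (9)ℕ their
`SLE₆` exponent `5/4`, and (B) the quasi-multiplicativity of `π₄ = critFourArmProb` at `p = 1/2`
(Smirnov–Werner's "(10) approximate multiplicativity"; Kesten 1987; Nolin 2008, Prop. 17). This
file PROVES (B) from ONE discrete input, stated as an explicit hypothesis: the comparability
`c · π₄(n, N) ≤ P_{1/2}(sepFourArm n N)` (`n₀ ≤ n`, `2n ≤ N`) of the well-separated four-arm event
with alternating colours (`ArmSeparationFourArm.lean`) with the four-arm event — Nolin's
arm-separation theorem (Thm. 11 [arXiv 0711.4948: Thm. 10], after Kesten) for `j = 4` together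
with colour switching (§5.1; Smirnov–Werner 2001, Remark after Thm. 1) for the adjacent colour
arrangement, which the tree's unordered `armEvent ![true, false, true, false]` also contains.
Everything in this file is proved; it introduces no definitions and no named facts.

## Contents

* `exists_le_real_fourGluePiece`, `exists_le_real_fourGlue` — **RSW**: `P_{1/2}(fourGlue q) ≥ c`
  and `P_{1/2}(fourGlueExt q) ≥ c` for all `q ≥ 1` (`c = c₀ ^ 73`, `c₀` the box-crossing constant
  of `tri_rsw_half_holds` at aspect ratio `98`; Harris chain `sitePercolation_real_biInter_ge_prod`).
* `sepFour_mul_sepFour_mul_glue_le` — **the gluing inequality**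
  `P(sep₄(n₁, 64q)) · P(sep₄(512(q+1), n₃)) · P(G)^4 ≤ π₄(n₁, n₃)`: Nolin's Lemma 13 [arXiv
  Lemma 12] (generalised FKG for locally monotone events, `triSitePercolation_locallyMonotone_fkg`,
  PROVED in the tree) with the shared region `Λ_{64q} ∪ {512(q+1) ≤ |·|_𝕋 ≤ n₃ + n₃/8}`, the
  cones over sides `0, 3` of the middle annulus (increasing part: open free spaces and open tubes)
  and over sides `1, 4` (decreasing part), independence of the two well-separated events and of the
  tubes of different frames (disjoint supports), invariance of `P_{1/2}` under `readFrame`, and the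
  deterministic gluing `sepFourArm_glue_subset`; `sepFour_mul_glueExt_le` — **the extension
  inequality** `P(sep₄(n₁, 64q)) · P(G_ext)^4 ≤ π₄(n₁, 512(q+1) - 1)`.
* `critFourArmProb_extend_of_separation`, `critFourArmProb_quasiMult_spaced_of_separation`,
  `critFourArmProb_quasiMult_of_separation` — extendability, quasi-multiplicativity along the
  scales `64q ≤ 512(q+1)`, and **(B) in the shape consumed by
  `fourArm_exponent_of_scaleBounds_crit`**: `c · π₄(r, R) · π₄(4R, S) ≤ π₄(r, S)` for `n₀ ≤ r`,
  `16 r < 4R < S` (with `q = ⌊R/64⌋`; the bounded-ratio case `S < 1024(q+1)` by two extensions).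
* `fourArm_exponent_of_separation` — **(16)ℕ ∧ (9)ℕ ∧ separation ⇒ `fourArm_exponent`**.
* Sanity checks: `cone_mem_sepOpenArm`, `biCone_mem_sepFourArm` (the configuration open exactly
  on the two opposite cones over sides `0`, `3` lies in `sepFourArm n N` for `16 ≤ n ≤ N`) and
  `triSitePercolation_sepFourArm_pos` (`P_{1/2}(sepFourArm n N) > 0`, the necessary condition for
  the separation hypothesis, since `π₄ > 0`).

## Faithfulness

Nolin's Prop. 12/17 are uniform in `p` near `1/2` below `L(p)` and hold for general `j`, `σ`;
only `p = 1/2`, `j = 4`, `σ = BWBW` is treated, which is what `fourArm_exponent` needs. The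
numerical thresholds (`64`, `512`, `1024`, `32`, aspect ratio `98`) are artefacts of the explicit
boxes and only affect constants and thresholds, which the statements leave unspecified. The
separation hypothesis is the `j = 4` analogue of the tree's named fact
`Nolin2008_twoArm_separation` (`ArmSeparation.lean`); it is kept as a hypothesis (no named fact is
introduced here, D-0026), to be discharged by the arm-separation programme.

## References

* P. Nolin, *Near-critical percolation in two dimensions*, Electron. J. Probab. 13 (2008),
  1562–1623, §4.3 (Thm. 11, Prop. 12, Lemma 13, Prop. 14), §4.5 (Prop. 17), §5.1 (colour
  switching) [arXiv 0711.4948: Thm. 10, Prop. 11, Lemma 12, Prop. 13, Prop. 16]. [Nolin2008]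
* S. Smirnov, W. Werner, *Critical exponents for two-dimensional percolation*, Math. Res. Lett. 8
  (2001), 729–744, Thm. 4 (`j = 4`), §4 (9), (10), (15), (16), §4.2, Remark after Thm. 1.
  [SmirnovWernerMRL2001]
* H. Kesten, *Scaling relations for 2D-percolation*, Comm. Math. Phys. 109 (1987), 109–156.
  [Kesten1987]

Mathlib search: no percolation / arm events / RSW in Mathlib; used from Mathlib:
`pow_le_pow_left₀`, `Finset.prod_le_prod`, `Nat.floor_natCast`, `min_le_left/right`. Tree:
`ArmSeparationFourArm.lean` (events, gluing construction, deterministic gluing),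
`LocallyMonotoneFKG.lean` (`triSitePercolation_locallyMonotone_fkg`), `ArmExponentsFourArmProofs.lean`
(`fourArm_exponent_of_limits_nat_crit`), `ArmEventsProofs.lean` (`polyArmProb_anti_holds`,
`polyArmProb_nonneg`, `polyArmProb_le_one`), `ArmSeparationProofs.lean` (`polyArmProb_mono_left`),
`TriThetaHalf.lean` (`tri_rsw_half_holds`), `TriRSWChaining.lean`
(`triSitePercolation_real_triHCross/VCross`, `triLRCrossingProb_anti_width`), `SiteHarrisChain.lean`,
`SitePercolationMeasure.lean` (`sitePercolation_real_inter_of_disjoint`), `KestenScaling.lean`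
(`critFourArmProb`), `ArmSeparationNonvacuity.lean` (straight segments, `site_mk_*`),
`ArmEventsProofs.lean` (`TwoArmPos.triSitePercolation_half_cylinder_pos`).
-/

noncomputable section

open MeasureTheory Set

namespace Literature.Probability.Percolation

open LatticeModels

open Filter Topology

/-! ### RSW lower bounds for the gluing events -/

/-- **RSW for the pieces.** There is `c₀ > 0` (the box-crossing constant of `tri_rsw_half_holds` at
aspect ratio `98`) with `P_{1/2}(fourGluePiece q k) ≥ c₀` for all `q ≥ 1`, `k < 73`: every box has
aspect ratio at most `49` in either direction. [cite: Nolin2008, §4.3 Prop. 12 (proof) (arXiv 0711.4948: Prop. 11)] -/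
theorem exists_le_real_fourGluePiece :
    ∃ c₀ : ℝ, 0 < c₀ ∧ ∀ q : ℕ, 1 ≤ q → ∀ k < 73, c₀ ≤ (triSitePercolation half).real (fourGluePiece q k) := by
  classical
  obtain ⟨c₀, hc₀, hrsw⟩ := tri_rsw_half_holds (98 : ℝ) (by norm_num)
  have key : ∀ w h : ℕ, 1 ≤ h → w ≤ 98 * h → c₀ ≤ triLRCrossingProb half w h := by
    intro w h hh hw
    have hfl : ⌊(98 : ℝ) * h⌋₊ = 98 * h := by
      have : (98 : ℝ) * h = ((98 * h : ℕ) : ℝ) := by push_cast; ring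
      rw [this, Nat.floor_natCast]
    obtain ⟨h1, -⟩ := hrsw h (by rw [hfl]; omega)
    rw [hfl] at h1
    exact h1.trans (triLRCrossingProb_anti_width half hw h)
  refine ⟨c₀, hc₀, fun q hq k _ => ?_⟩
  unfold fourGluePiece fourGlueBox
  split_ifs <;> dsimp only <;> first
    | (rw [triSitePercolation_real_triVCross]; exact key _ _ (by omega) (by omega))
    | (rw [triSitePercolation_real_triHCross]; exact key _ _ (by omega) (by omega))

/-- **RSW lower bound for the gluing and extension events**: there is `c > 0` with
`P_{1/2}(fourGlue q) ≥ c` and `P_{1/2}(fourGlueExt q) ≥ c` for all `q ≥ 1` (`c = c₀ ^ 73`, Harris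
chain `sitePercolation_real_biInter_ge_prod`). [cite: Nolin2008, §4.3 Prop. 12 (proof) (arXiv 0711.4948: Prop. 11)] -/
theorem exists_le_real_fourGlue :
    ∃ c : ℝ, 0 < c ∧ ∀ q : ℕ, 1 ≤ q →
      c ≤ (triSitePercolation half).real (fourGlue q) ∧ c ≤ (triSitePercolation half).real (fourGlueExt q) := by
  classical
  obtain ⟨c₀, hc₀, h⟩ := exists_le_real_fourGluePiece
  refine ⟨c₀ ^ 73, by positivity, fun q hq => ?_⟩
  have hG : c₀ ^ 73 ≤ (triSitePercolation half).real (fourGlue q) := by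
    have hp := sitePercolation_real_biInter_ge_prod half (Finset.range 73) (E := fourGluePiece q)
      (F := fourGluePieceFinset q) (fun k _ => determinedBy_fourGluePiece q k)
      (fun k _ => isUpperSet_fourGluePiece q k)
    refine le_trans ?_ hp
    calc c₀ ^ 73 = ∏ _i ∈ Finset.range 73, c₀ := by simp
      _ ≤ ∏ k ∈ Finset.range 73, (sitePercolation (Site 2) half).real (fourGluePiece q k) :=
          Finset.prod_le_prod (fun _ _ => hc₀.le) fun k hk => h q hq k (Finset.mem_range.1 hk)
  exact ⟨hG, hG.trans (measureReal_mono (fourGlue_subset_fourGlueExt q) (measure_ne_top _ _))⟩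

/-! ### Supports in the four frames -/

/-- The rotated supports of the inner well-separated event lie in `Λ_{72q}`. [folklore] -/
theorem image_rot_sepConeSupport_inner_subset (a : ℕ) {n₁ q : ℕ} :
    triRotIsoPow a '' sepConeSupport n₁ (64 * q) ⊆ ↑(triBall (72 * q)) := by
  rintro w ⟨v, hv, rfl⟩
  have e8 : 64 * q / 8 = 8 * q := by omega
  rw [mem_sepConeSupport, e8] at hv
  rw [Finset.mem_coe, mem_triBall_iff, triNorm_rot]
  push_cast at hv ⊢; omega

/-- The rotated supports of the outer well-separated event lie in `{448Q ≤ |·|_𝕋 ≤ n₃ + n₃/8}`. [folklore] -/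
theorem image_rot_sepConeSupport_outer_subset (a : ℕ) {n₃ q : ℕ} :
    triRotIsoPow a '' sepConeSupport (512 * (q + 1)) n₃ ⊆
      ↑((triBall (n₃ + n₃ / 8)).filter (fun v => 448 * ((q : ℤ) + 1) ≤ triNorm v)) := by
  rintro w ⟨v, hv, rfl⟩
  have E8 : 512 * (q + 1) / 8 = 64 * (q + 1) := by omega
  rw [mem_sepConeSupport, E8] at hv
  rw [Finset.mem_coe, Finset.mem_filter, mem_triBall_iff, triNorm_rot]
  push_cast at hv ⊢; omega

/-- The gluing events of the frames `0` and `3` (and of `1` and `4`) are determined by disjoint sets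
of sites. [folklore] -/
theorem disjoint_image_rot_of_cone {a b : ℕ} (ha : a < 6) (hb : b < 6) (hab : a ≠ b) {F : Finset (Site 2)}
    (hF : ∀ v ∈ F, 0 < v 0 ∧ v 1 < 0 ∧ 0 < v 0 + v 1) :
    Disjoint (F.image (triRotIsoPow a)) (F.image (triRotIsoPow b)) := by
  classical
  rw [Finset.disjoint_left]
  intro w hwa hwb
  rw [Finset.mem_image] at hwa hwb
  obtain ⟨v, hv, hvw⟩ := hwa
  obtain ⟨v', hv', hv'w⟩ := hwb
  exact hab (rot_sector_injective ha hb (hF v hv) (hF v' hv') (hvw.trans hv'w.symm))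

/-- Independence of the gluing events of two different frames: the probability of their
intersection is `P_{1/2}(G)²`. [folklore] -/
theorem real_inter_preimage_readFrame_of_cone {a b : ℕ} (ha : a < 6) (hb : b < 6) (hab : a ≠ b)
    (c c' : Bool) {G : Set (SiteConfig (Site 2))} {F : Finset (Site 2)} (hG : DeterminedBy G ↑F)
    (hF : ∀ v ∈ F, 0 < v 0 ∧ v 1 < 0 ∧ 0 < v 0 + v 1) :
    (triSitePercolation half).real (readFrame a c ⁻¹' G ∩ readFrame b c' ⁻¹' G) =
      (triSitePercolation half).real G * (triSitePercolation half).real G := by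
  classical
  have da : DeterminedBy (readFrame a c ⁻¹' G) ↑(F.image (triRotIsoPow a)) := by
    rw [Finset.coe_image]; exact determinedBy_preimage_readFrame a c hG
  have db : DeterminedBy (readFrame b c' ⁻¹' G) ↑(F.image (triRotIsoPow b)) := by
    rw [Finset.coe_image]; exact determinedBy_preimage_readFrame b c' hG
  have h := sitePercolation_real_inter_of_disjoint half da db (disjoint_image_rot_of_cone ha hb hab hF)
  unfold triSitePercolation at *
  rw [h]
  have ea := real_preimage_readFrame a c G
  have eb := real_preimage_readFrame b c' G
  unfold triSitePercolation at ea eb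
  rw [ea, eb]

/-! ### The gluing inequalities (Nolin 2008, Prop. 12, Lemma 13) -/

set_option maxHeartbeats 1600000 in
set_option maxRecDepth 4096 in
/-- **The gluing inequality for four arms** (Nolin 2008, Prop. 12 [arXiv 0711.4948: Prop. 11],
item "quasi-multiplicativity" for well-separated events, `j = 4`, alternating colours, `p = 1/2`,
hexagonal annuli at the scales `64q ≤ 512(q+1)`):
`P(sep₄(n₁, 64q)) · P(sep₄(512(q+1), n₃)) · P(G)^4 ≤ π₄(n₁, n₃)`. Proof as printed: the generalised
FKG inequality for locally monotone events (Nolin Lemma 13 [arXiv Lemma 12],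
`triSitePercolation_locallyMonotone_fkg`) with the shared region `Λ_{64q} ∪ {512(q+1) ≤ |·|_𝕋}`,
the cones over sides `0`, `3` of the middle annulus (open free spaces and open tubes: increasing)
and the cones over sides `1`, `4` (closed ones: decreasing), independence of the two well-separated
events (disjoint supports) and of the tubes of different frames, invariance of `P_{1/2}` under
`readFrame`, and the deterministic gluing `sepFourArm_glue_subset`. [cite: Nolin2008, §4.3 Prop. 12 and Lemma 13 (arXiv 0711.4948: Prop. 11, Lemma 12)] -/
theorem sepFour_mul_sepFour_mul_glue_le {q n₁ n₃ : ℕ} (hq : 1 ≤ q) (h4 : 4 ≤ n₁) (h₁ : n₁ ≤ 64 * q)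
    (h₃ : 512 * (q + 1) ≤ n₃) :
    (triSitePercolation half).real (sepFourArm n₁ (64 * q)) *
        (triSitePercolation half).real (sepFourArm (512 * (q + 1)) n₃) *
        (triSitePercolation half).real (fourGlue q) ^ 4 ≤ critFourArmProb n₁ n₃ := by
  classical
  -- the three pairwise disjoint regions of Nolin's Lemma 13
  set S : Finset (Site 2) := triBall (64 * q) ∪
    (triBall (n₃ + n₃ / 8)).filter (fun v => 512 * ((q : ℤ) + 1) ≤ triNorm v) with hS
  set P : Finset (Site 2) := (triBall (512 * (q + 1))).filter
    (fun v => (64 * q : ℤ) < triNorm v ∧ triNorm v < 512 * ((q : ℤ) + 1) ∧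
      ((0 < v 0 ∧ v 1 < 0 ∧ 0 < v 0 + v 1) ∨ (v 0 < 0 ∧ 0 < v 1 ∧ v 0 + v 1 < 0))) with hP
  set M : Finset (Site 2) := (triBall (512 * (q + 1))).filter
    (fun v => (64 * q : ℤ) < triNorm v ∧ triNorm v < 512 * ((q : ℤ) + 1) ∧
      ((0 < v 0 ∧ 0 < v 1) ∨ (v 0 < 0 ∧ v 1 < 0))) with hM
  have hSP : Disjoint S P := by
    rw [Finset.disjoint_left]; intro v hvS hvP
    simp only [hS, hP, Finset.mem_union, Finset.mem_filter, mem_triBall_iff] at hvS hvP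
    push_cast at hvS hvP; omega
  have hSM : Disjoint S M := by
    rw [Finset.disjoint_left]; intro v hvS hvM
    simp only [hS, hM, Finset.mem_union, Finset.mem_filter, mem_triBall_iff] at hvS hvM
    push_cast at hvS hvM; omega
  have hPM : Disjoint P M := by
    rw [Finset.disjoint_left]; intro v hvP hvM
    simp only [hP, hM, Finset.mem_filter] at hvP hvM
    omega
  have e8 : 64 * q / 8 = 8 * q := by omega
  have E8 : 512 * (q + 1) / 8 = 64 * (q + 1) := by omega
  have hq' : (1 : ℤ) ≤ q := by exact_mod_cast hq
  have h₃' : (512 : ℤ) * (q + 1) ≤ n₃ := by exact_mod_cast h₃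
  -- supports of the arm events: inner scale
  have hIn0 : triRotIsoPow 0 '' sepConeSupport n₁ (64 * q) ⊆ ↑S ∪ ↑P := by
    rintro w ⟨v, hv, rfl⟩
    rw [mem_sepConeSupport, e8] at hv
    simp only [triRotIsoPow_zero_apply, Set.mem_union, Finset.mem_coe, hS, hP, Finset.mem_union,
      Finset.mem_filter, mem_triBall_iff]
    push_cast at hv ⊢; omega
  have hIn3 : triRotIsoPow 3 '' sepConeSupport n₁ (64 * q) ⊆ ↑S ∪ ↑P := by
    rintro w ⟨v, hv, rfl⟩
    rw [mem_sepConeSupport, e8] at hv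
    obtain ⟨-, -, -, -, -, -, r30, r31, -⟩ := rot_apply_formula v
    have hn := triNorm_rot 3 v
    simp only [Set.mem_union, Finset.mem_coe, hS, hP, Finset.mem_union, Finset.mem_filter, mem_triBall_iff,
      r30, r31, hn]
    push_cast at hv ⊢; omega
  have hIn1 : triRotIsoPow 1 '' sepConeSupport n₁ (64 * q) ⊆ ↑S ∪ ↑M := by
    rintro w ⟨v, hv, rfl⟩
    rw [mem_sepConeSupport, e8] at hv
    obtain ⟨-, -, r10, r11, -⟩ := rot_apply_formula v
    have hn := triNorm_rot 1 v
    simp only [Set.mem_union, Finset.mem_coe, hS, hM, Finset.mem_union, Finset.mem_filter, mem_triBall_iff,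
      r10, r11, hn]
    push_cast at hv ⊢; omega
  have hIn4 : triRotIsoPow 4 '' sepConeSupport n₁ (64 * q) ⊆ ↑S ∪ ↑M := by
    rintro w ⟨v, hv, rfl⟩
    rw [mem_sepConeSupport, e8] at hv
    obtain ⟨-, -, -, -, -, -, -, -, r40, r41, -⟩ := rot_apply_formula v
    have hn := triNorm_rot 4 v
    simp only [Set.mem_union, Finset.mem_coe, hS, hM, Finset.mem_union, Finset.mem_filter, mem_triBall_iff,
      r40, r41, hn]
    push_cast at hv ⊢; omega
  -- supports of the arm events: outer scale
  have hOut0 : triRotIsoPow 0 '' sepConeSupport (512 * (q + 1)) n₃ ⊆ ↑S ∪ ↑P := by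
    rintro w ⟨v, hv, rfl⟩
    rw [mem_sepConeSupport, E8] at hv
    simp only [triRotIsoPow_zero_apply, Set.mem_union, Finset.mem_coe, hS, hP, Finset.mem_union,
      Finset.mem_filter, mem_triBall_iff]
    push_cast at hv ⊢; omega
  have hOut3 : triRotIsoPow 3 '' sepConeSupport (512 * (q + 1)) n₃ ⊆ ↑S ∪ ↑P := by
    rintro w ⟨v, hv, rfl⟩
    rw [mem_sepConeSupport, E8] at hv
    obtain ⟨-, -, -, -, -, -, r30, r31, -⟩ := rot_apply_formula v
    have hn := triNorm_rot 3 v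
    simp only [Set.mem_union, Finset.mem_coe, hS, hP, Finset.mem_union, Finset.mem_filter, mem_triBall_iff,
      r30, r31, hn]
    push_cast at hv ⊢; omega
  have hOut1 : triRotIsoPow 1 '' sepConeSupport (512 * (q + 1)) n₃ ⊆ ↑S ∪ ↑M := by
    rintro w ⟨v, hv, rfl⟩
    rw [mem_sepConeSupport, E8] at hv
    obtain ⟨-, -, r10, r11, -⟩ := rot_apply_formula v
    have hn := triNorm_rot 1 v
    simp only [Set.mem_union, Finset.mem_coe, hS, hM, Finset.mem_union, Finset.mem_filter, mem_triBall_iff,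
      r10, r11, hn]
    push_cast at hv ⊢; omega
  have hOut4 : triRotIsoPow 4 '' sepConeSupport (512 * (q + 1)) n₃ ⊆ ↑S ∪ ↑M := by
    rintro w ⟨v, hv, rfl⟩
    rw [mem_sepConeSupport, E8] at hv
    obtain ⟨-, -, -, -, -, -, -, -, r40, r41, -⟩ := rot_apply_formula v
    have hn := triNorm_rot 4 v
    simp only [Set.mem_union, Finset.mem_coe, hS, hM, Finset.mem_union, Finset.mem_filter, mem_triBall_iff,
      r40, r41, hn]
    push_cast at hv ⊢; omega
  -- supports of the gluing events
  have hGF : ∀ v ∈ fourGlueFinset q, 0 < v 0 ∧ v 1 < 0 ∧ 0 < v 0 + v 1 := by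
    intro v hv
    have h := fourGlueFinset_subset hq hv
    exact ⟨by omega, h.2.2.1, h.2.2.2⟩
  have hG0 : triRotIsoPow 0 '' (↑(fourGlueFinset q) : Set (Site 2)) ⊆ ↑P := by
    rintro w ⟨v, hv, rfl⟩
    have h := fourGlueFinset_subset hq (Finset.mem_coe.1 hv)
    have hn : triNorm v = v 0 := triNorm_eq_apply_zero h.2.2.1.le h.2.2.2.le
    simp only [triRotIsoPow_zero_apply, Finset.mem_coe, hP, Finset.mem_filter, mem_triBall_iff, hn]
    push_cast; omega
  have hG3 : triRotIsoPow 3 '' (↑(fourGlueFinset q) : Set (Site 2)) ⊆ ↑P := by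
    rintro w ⟨v, hv, rfl⟩
    have h := fourGlueFinset_subset hq (Finset.mem_coe.1 hv)
    have hn : triNorm (triRotIsoPow 3 v) = v 0 := by
      rw [triNorm_rot]; exact triNorm_eq_apply_zero h.2.2.1.le h.2.2.2.le
    obtain ⟨-, -, -, -, -, -, r30, r31, -⟩ := rot_apply_formula v
    simp only [Finset.mem_coe, hP, Finset.mem_filter, mem_triBall_iff, hn, r30, r31]
    push_cast; omega
  have hG1 : triRotIsoPow 1 '' (↑(fourGlueFinset q) : Set (Site 2)) ⊆ ↑M := by
    rintro w ⟨v, hv, rfl⟩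
    have h := fourGlueFinset_subset hq (Finset.mem_coe.1 hv)
    have hn : triNorm (triRotIsoPow 1 v) = v 0 := by
      rw [triNorm_rot]; exact triNorm_eq_apply_zero h.2.2.1.le h.2.2.2.le
    obtain ⟨-, -, r10, r11, -⟩ := rot_apply_formula v
    simp only [Finset.mem_coe, hM, Finset.mem_filter, mem_triBall_iff, hn, r10, r11]
    push_cast; omega
  have hG4 : triRotIsoPow 4 '' (↑(fourGlueFinset q) : Set (Site 2)) ⊆ ↑M := by
    rintro w ⟨v, hv, rfl⟩
    have h := fourGlueFinset_subset hq (Finset.mem_coe.1 hv)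
    have hn : triNorm (triRotIsoPow 4 v) = v 0 := by
      rw [triNorm_rot]; exact triNorm_eq_apply_zero h.2.2.1.le h.2.2.2.le
    obtain ⟨-, -, -, -, -, -, -, -, r40, r41, -⟩ := rot_apply_formula v
    simp only [Finset.mem_coe, hM, Finset.mem_filter, mem_triBall_iff, hn, r40, r41]
    push_cast; omega
  -- locality of the events
  have h4' : 4 ≤ 512 * (q + 1) := by omega
  have dA₁ := determinedBy_sepArmPair 0 true h4 h₁
  have dA₂ := determinedBy_sepArmPair 0 true h4' h₃
  have dC₁ := determinedBy_sepArmPair 1 false h4 h₁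
  have dC₂ := determinedBy_sepArmPair 1 false h4' h₃
  have dG := determinedBy_fourGlue q
  -- the events
  set A₁ := sepArmPair 0 true n₁ (64 * q) with hA₁
  set A₂ := sepArmPair 0 true (512 * (q + 1)) n₃ with hA₂
  set C₁ := sepArmPair 1 false n₁ (64 * q) with hC₁
  set C₂ := sepArmPair 1 false (512 * (q + 1)) n₃ with hC₂
  set G := fourGlue q with hGdef
  -- Nolin's Lemma 13
  have fkg := triSitePercolation_locallyMonotone_fkg half hSP hSM hPM
    (Ap := A₁ ∩ A₂) (Am := C₁ ∩ C₂)
    (Bp := readFrame 0 true ⁻¹' G ∩ readFrame 3 true ⁻¹' G)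
    (Bm := readFrame 1 false ⁻¹' G ∩ readFrame 4 false ⁻¹' G)
    ((isUpperSet_sepArmPair_true 0 n₁ (64 * q)).inter (isUpperSet_sepArmPair_true 0 (512 * (q + 1)) n₃))
    ((isLowerSet_sepArmPair_false 1 n₁ (64 * q)).inter (isLowerSet_sepArmPair_false 1 (512 * (q + 1)) n₃))
    ((IsUpperSet.preimage_readFrame_true 0 (isUpperSet_fourGlue q)).inter
      (IsUpperSet.preimage_readFrame_true 3 (isUpperSet_fourGlue q)))
    ((IsUpperSet.preimage_readFrame_false 1 (isUpperSet_fourGlue q)).inter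
      (IsUpperSet.preimage_readFrame_false 4 (isUpperSet_fourGlue q)))
    ((dA₁.mono (union_subset hIn0 hIn3)).inter (dA₂.mono (union_subset hOut0 hOut3)))
    ((dC₁.mono (union_subset hIn1 hIn4)).inter (dC₂.mono (union_subset hOut1 hOut4)))
    (((determinedBy_preimage_readFrame 0 true dG).mono hG0).inter
      ((determinedBy_preimage_readFrame 3 true dG).mono hG3))
    (((determinedBy_preimage_readFrame 1 false dG).mono hG1).inter
      ((determinedBy_preimage_readFrame 4 false dG).mono hG4))
  have hAA : A₁ ∩ A₂ ∩ (C₁ ∩ C₂) = sepFourArm n₁ (64 * q) ∩ sepFourArm (512 * (q + 1)) n₃ :=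
    Set.inter_inter_inter_comm _ _ _ _
  -- independence of the two well-separated events
  have dS₁ : DeterminedBy (sepFourArm n₁ (64 * q)) ↑(triBall (72 * q)) :=
    (dA₁.mono (union_subset (image_rot_sepConeSupport_inner_subset 0)
      (image_rot_sepConeSupport_inner_subset (0 + 3)))).inter
    (dC₁.mono (union_subset (image_rot_sepConeSupport_inner_subset 1)
      (image_rot_sepConeSupport_inner_subset (1 + 3))))
  have dS₂ : DeterminedBy (sepFourArm (512 * (q + 1)) n₃)
      ↑((triBall (n₃ + n₃ / 8)).filter (fun v => 448 * ((q : ℤ) + 1) ≤ triNorm v)) :=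
    (dA₂.mono (union_subset (image_rot_sepConeSupport_outer_subset 0)
      (image_rot_sepConeSupport_outer_subset (0 + 3)))).inter
    (dC₂.mono (union_subset (image_rot_sepConeSupport_outer_subset 1)
      (image_rot_sepConeSupport_outer_subset (1 + 3))))
  have hdisj : Disjoint (triBall (72 * q))
      ((triBall (n₃ + n₃ / 8)).filter (fun v => 448 * ((q : ℤ) + 1) ≤ triNorm v)) := by
    rw [Finset.disjoint_left]; intro v hv hv'
    simp only [Finset.mem_filter, mem_triBall_iff] at hv hv'
    push_cast at hv hv'; omega
  have hind : (triSitePercolation half).real (sepFourArm n₁ (64 * q) ∩ sepFourArm (512 * (q + 1)) n₃) =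
      (triSitePercolation half).real (sepFourArm n₁ (64 * q)) *
        (triSitePercolation half).real (sepFourArm (512 * (q + 1)) n₃) :=
    sitePercolation_real_inter_of_disjoint half dS₁ dS₂ hdisj
  -- independence of the tubes of different frames
  have hBp : (triSitePercolation half).real (readFrame 0 true ⁻¹' G ∩ readFrame 3 true ⁻¹' G) =
      (triSitePercolation half).real G * (triSitePercolation half).real G :=
    real_inter_preimage_readFrame_of_cone (by norm_num) (by norm_num) (by norm_num) true true dG hGF
  have hBm : (triSitePercolation half).real (readFrame 1 false ⁻¹' G ∩ readFrame 4 false ⁻¹' G) =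
      (triSitePercolation half).real G * (triSitePercolation half).real G :=
    real_inter_preimage_readFrame_of_cone (by norm_num) (by norm_num) (by norm_num) false false dG hGF
  -- the deterministic gluing
  have hsub : A₁ ∩ A₂ ∩ (C₁ ∩ C₂) ∩
      (readFrame 0 true ⁻¹' G ∩ readFrame 3 true ⁻¹' G ∩ (readFrame 1 false ⁻¹' G ∩ readFrame 4 false ⁻¹' G)) ⊆
      armEvent ![true, false, true, false] n₁ n₃ := by
    rintro ω ⟨⟨⟨hA1, hA2⟩, hC1, hC2⟩, hBp', hBm'⟩
    exact sepFourArm_glue_subset hq h4 h₁ h₃ ⟨⟨⟨hA1, hC1⟩, hBp', hBm'⟩, hA2, hC2⟩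
  calc (triSitePercolation half).real (sepFourArm n₁ (64 * q)) *
        (triSitePercolation half).real (sepFourArm (512 * (q + 1)) n₃) *
        (triSitePercolation half).real G ^ 4
      = (triSitePercolation half).real (A₁ ∩ A₂ ∩ (C₁ ∩ C₂)) *
          ((triSitePercolation half).real (readFrame 0 true ⁻¹' G ∩ readFrame 3 true ⁻¹' G) *
            (triSitePercolation half).real (readFrame 1 false ⁻¹' G ∩ readFrame 4 false ⁻¹' G)) := by
        rw [hAA, hind, hBp, hBm]; ring
    _ ≤ _ := fkg
    _ ≤ critFourArmProb n₁ n₃ := measureReal_mono hsub (measure_ne_top _ _)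

set_option maxHeartbeats 1600000 in
set_option maxRecDepth 4096 in
/-- **The extension inequality for four arms** (Nolin 2008, Prop. 12 (i) [arXiv 0711.4948:
Prop. 11], extendability, `j = 4`, alternating colours, `p = 1/2`):
`P(sep₄(n₁, 64q)) · P(G_ext)^4 ≤ π₄(n₁, 512(q+1) - 1)`, by the same locally monotone FKG argument
with the shared region `Λ_{64q}` and the deterministic extension `sepFourArm_glueExt_subset`. [cite: Nolin2008, §4.3 Prop. 12 and Lemma 13 (arXiv 0711.4948: Prop. 11, Lemma 12)] -/
theorem sepFour_mul_glueExt_le {q n₁ : ℕ} (hq : 1 ≤ q) (h4 : 4 ≤ n₁) (h₁ : n₁ ≤ 64 * q) :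
    (triSitePercolation half).real (sepFourArm n₁ (64 * q)) *
        (triSitePercolation half).real (fourGlueExt q) ^ 4 ≤ critFourArmProb n₁ (512 * (q + 1) - 1) := by
  classical
  set S : Finset (Site 2) := triBall (64 * q) with hS
  set P : Finset (Site 2) := (triBall (512 * (q + 1))).filter
    (fun v => (64 * q : ℤ) < triNorm v ∧ triNorm v < 512 * ((q : ℤ) + 1) ∧
      ((0 < v 0 ∧ v 1 < 0 ∧ 0 < v 0 + v 1) ∨ (v 0 < 0 ∧ 0 < v 1 ∧ v 0 + v 1 < 0))) with hP
  set M : Finset (Site 2) := (triBall (512 * (q + 1))).filter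
    (fun v => (64 * q : ℤ) < triNorm v ∧ triNorm v < 512 * ((q : ℤ) + 1) ∧
      ((0 < v 0 ∧ 0 < v 1) ∨ (v 0 < 0 ∧ v 1 < 0))) with hM
  have hSP : Disjoint S P := by
    rw [Finset.disjoint_left]; intro v hvS hvP
    simp only [hS, hP, Finset.mem_filter, mem_triBall_iff] at hvS hvP
    push_cast at hvS hvP; omega
  have hSM : Disjoint S M := by
    rw [Finset.disjoint_left]; intro v hvS hvM
    simp only [hS, hM, Finset.mem_filter, mem_triBall_iff] at hvS hvM
    push_cast at hvS hvM; omega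
  have hPM : Disjoint P M := by
    rw [Finset.disjoint_left]; intro v hvP hvM
    simp only [hP, hM, Finset.mem_filter] at hvP hvM
    omega
  have e8 : 64 * q / 8 = 8 * q := by omega
  have hq' : (1 : ℤ) ≤ q := by exact_mod_cast hq
  -- supports of the arm events
  have hIn0 : triRotIsoPow 0 '' sepConeSupport n₁ (64 * q) ⊆ ↑S ∪ ↑P := by
    rintro w ⟨v, hv, rfl⟩
    rw [mem_sepConeSupport, e8] at hv
    simp only [triRotIsoPow_zero_apply, Set.mem_union, Finset.mem_coe, hS, hP, Finset.mem_filter, mem_triBall_iff]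
    push_cast at hv ⊢; omega
  have hIn3 : triRotIsoPow 3 '' sepConeSupport n₁ (64 * q) ⊆ ↑S ∪ ↑P := by
    rintro w ⟨v, hv, rfl⟩
    rw [mem_sepConeSupport, e8] at hv
    obtain ⟨-, -, -, -, -, -, r30, r31, -⟩ := rot_apply_formula v
    have hn := triNorm_rot 3 v
    simp only [Set.mem_union, Finset.mem_coe, hS, hP, Finset.mem_filter, mem_triBall_iff, r30, r31, hn]
    push_cast at hv ⊢; omega
  have hIn1 : triRotIsoPow 1 '' sepConeSupport n₁ (64 * q) ⊆ ↑S ∪ ↑M := by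
    rintro w ⟨v, hv, rfl⟩
    rw [mem_sepConeSupport, e8] at hv
    obtain ⟨-, -, r10, r11, -⟩ := rot_apply_formula v
    have hn := triNorm_rot 1 v
    simp only [Set.mem_union, Finset.mem_coe, hS, hM, Finset.mem_filter, mem_triBall_iff, r10, r11, hn]
    push_cast at hv ⊢; omega
  have hIn4 : triRotIsoPow 4 '' sepConeSupport n₁ (64 * q) ⊆ ↑S ∪ ↑M := by
    rintro w ⟨v, hv, rfl⟩
    rw [mem_sepConeSupport, e8] at hv
    obtain ⟨-, -, -, -, -, -, -, -, r40, r41, -⟩ := rot_apply_formula v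
    have hn := triNorm_rot 4 v
    simp only [Set.mem_union, Finset.mem_coe, hS, hM, Finset.mem_filter, mem_triBall_iff, r40, r41, hn]
    push_cast at hv ⊢; omega
  -- supports of the extension events
  have hGF : ∀ v ∈ fourGlueExtFinset q, 0 < v 0 ∧ v 1 < 0 ∧ 0 < v 0 + v 1 := by
    intro v hv
    have h := fourGlueExtFinset_subset hq hv
    exact ⟨by omega, h.2.2.1, h.2.2.2⟩
  have hG0 : triRotIsoPow 0 '' (↑(fourGlueExtFinset q) : Set (Site 2)) ⊆ ↑P := by
    rintro w ⟨v, hv, rfl⟩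
    have h := fourGlueExtFinset_subset hq (Finset.mem_coe.1 hv)
    have hn : triNorm v = v 0 := triNorm_eq_apply_zero h.2.2.1.le h.2.2.2.le
    simp only [triRotIsoPow_zero_apply, Finset.mem_coe, hP, Finset.mem_filter, mem_triBall_iff, hn]
    push_cast; omega
  have hG3 : triRotIsoPow 3 '' (↑(fourGlueExtFinset q) : Set (Site 2)) ⊆ ↑P := by
    rintro w ⟨v, hv, rfl⟩
    have h := fourGlueExtFinset_subset hq (Finset.mem_coe.1 hv)
    have hn : triNorm (triRotIsoPow 3 v) = v 0 := by
      rw [triNorm_rot]; exact triNorm_eq_apply_zero h.2.2.1.le h.2.2.2.le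
    obtain ⟨-, -, -, -, -, -, r30, r31, -⟩ := rot_apply_formula v
    simp only [Finset.mem_coe, hP, Finset.mem_filter, mem_triBall_iff, hn, r30, r31]
    push_cast; omega
  have hG1 : triRotIsoPow 1 '' (↑(fourGlueExtFinset q) : Set (Site 2)) ⊆ ↑M := by
    rintro w ⟨v, hv, rfl⟩
    have h := fourGlueExtFinset_subset hq (Finset.mem_coe.1 hv)
    have hn : triNorm (triRotIsoPow 1 v) = v 0 := by
      rw [triNorm_rot]; exact triNorm_eq_apply_zero h.2.2.1.le h.2.2.2.le
    obtain ⟨-, -, r10, r11, -⟩ := rot_apply_formula v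
    simp only [Finset.mem_coe, hM, Finset.mem_filter, mem_triBall_iff, hn, r10, r11]
    push_cast; omega
  have hG4 : triRotIsoPow 4 '' (↑(fourGlueExtFinset q) : Set (Site 2)) ⊆ ↑M := by
    rintro w ⟨v, hv, rfl⟩
    have h := fourGlueExtFinset_subset hq (Finset.mem_coe.1 hv)
    have hn : triNorm (triRotIsoPow 4 v) = v 0 := by
      rw [triNorm_rot]; exact triNorm_eq_apply_zero h.2.2.1.le h.2.2.2.le
    obtain ⟨-, -, -, -, -, -, -, -, r40, r41, -⟩ := rot_apply_formula v
    simp only [Finset.mem_coe, hM, Finset.mem_filter, mem_triBall_iff, hn, r40, r41]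
    push_cast; omega
  -- locality
  have dA₁ := determinedBy_sepArmPair 0 true h4 h₁
  have dC₁ := determinedBy_sepArmPair 1 false h4 h₁
  have dG := determinedBy_fourGlueExt q
  set A₁ := sepArmPair 0 true n₁ (64 * q) with hA₁
  set C₁ := sepArmPair 1 false n₁ (64 * q) with hC₁
  set G := fourGlueExt q with hGdef
  have fkg := triSitePercolation_locallyMonotone_fkg half hSP hSM hPM (Ap := A₁) (Am := C₁)
    (Bp := readFrame 0 true ⁻¹' G ∩ readFrame 3 true ⁻¹' G)
    (Bm := readFrame 1 false ⁻¹' G ∩ readFrame 4 false ⁻¹' G)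
    (isUpperSet_sepArmPair_true 0 n₁ (64 * q)) (isLowerSet_sepArmPair_false 1 n₁ (64 * q))
    ((IsUpperSet.preimage_readFrame_true 0 (isUpperSet_fourGlueExt q)).inter
      (IsUpperSet.preimage_readFrame_true 3 (isUpperSet_fourGlueExt q)))
    ((IsUpperSet.preimage_readFrame_false 1 (isUpperSet_fourGlueExt q)).inter
      (IsUpperSet.preimage_readFrame_false 4 (isUpperSet_fourGlueExt q)))
    (dA₁.mono (union_subset hIn0 hIn3)) (dC₁.mono (union_subset hIn1 hIn4))
    (((determinedBy_preimage_readFrame 0 true dG).mono hG0).inter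
      ((determinedBy_preimage_readFrame 3 true dG).mono hG3))
    (((determinedBy_preimage_readFrame 1 false dG).mono hG1).inter
      ((determinedBy_preimage_readFrame 4 false dG).mono hG4))
  have hBp : (triSitePercolation half).real (readFrame 0 true ⁻¹' G ∩ readFrame 3 true ⁻¹' G) =
      (triSitePercolation half).real G * (triSitePercolation half).real G :=
    real_inter_preimage_readFrame_of_cone (by norm_num) (by norm_num) (by norm_num) true true dG hGF
  have hBm : (triSitePercolation half).real (readFrame 1 false ⁻¹' G ∩ readFrame 4 false ⁻¹' G) =
      (triSitePercolation half).real G * (triSitePercolation half).real G :=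
    real_inter_preimage_readFrame_of_cone (by norm_num) (by norm_num) (by norm_num) false false dG hGF
  have hsub : A₁ ∩ C₁ ∩
      (readFrame 0 true ⁻¹' G ∩ readFrame 3 true ⁻¹' G ∩ (readFrame 1 false ⁻¹' G ∩ readFrame 4 false ⁻¹' G)) ⊆
      armEvent ![true, false, true, false] n₁ (512 * (q + 1) - 1) := by
    rintro ω ⟨⟨hA1, hC1⟩, hBp', hBm'⟩
    exact sepFourArm_glueExt_subset hq h4 h₁ ⟨⟨hA1, hC1⟩, hBp', hBm'⟩
  calc (triSitePercolation half).real (sepFourArm n₁ (64 * q)) * (triSitePercolation half).real G ^ 4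
      = (triSitePercolation half).real (A₁ ∩ C₁) *
          ((triSitePercolation half).real (readFrame 0 true ⁻¹' G ∩ readFrame 3 true ⁻¹' G) *
            (triSitePercolation half).real (readFrame 1 false ⁻¹' G ∩ readFrame 4 false ⁻¹' G)) := by
        rw [hBp, hBm]; simp only [sepFourArm, hA₁, hC₁]; ring
    _ ≤ _ := fkg
    _ ≤ critFourArmProb n₁ (512 * (q + 1) - 1) := measureReal_mono hsub (measure_ne_top _ _)

/-! ### Quasi-multiplicativity of `π₄` at `p = 1/2` from four-arm separation -/

/-- **Extendability from separation** (Nolin 2008, Prop. 12 (i) [arXiv 0711.4948: Prop. 11] with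
Thm. 11 [arXiv Thm. 10], `j = 4`, `p = 1/2`): IF the well-separated four-arm event is comparable to
the four-arm event, `c · π₄(n, N) ≤ P_{1/2}(sepFourArm n N)` for `n₀ ≤ n`, `2n ≤ N`, THEN
`c_E · π₄(n, 64q) ≤ π₄(n, 512(q+1) - 1)` for `q ≥ 1`, `n₀ ∨ 4 ≤ n`, `2n ≤ 64q`
(`sepFour_mul_glueExt_le` and RSW). [cite: Nolin2008, §4.3 Prop. 12 (i) (arXiv 0711.4948: Prop. 11)] -/
theorem critFourArmProb_extend_of_separation
    (hsep : ∃ c : ℝ, 0 < c ∧ ∃ n₀ : ℕ, ∀ n N : ℕ, n₀ ≤ n → 2 * n ≤ N →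
      c * critFourArmProb n N ≤ (triSitePercolation half).real (sepFourArm n N)) :
    ∃ cE : ℝ, 0 < cE ∧ ∃ n₀ : ℕ, ∀ q n : ℕ, 1 ≤ q → n₀ ≤ n → 2 * n ≤ 64 * q →
      cE * critFourArmProb n (64 * q) ≤ critFourArmProb n (512 * (q + 1) - 1) := by
  obtain ⟨c, hc, n₀, hs⟩ := hsep
  obtain ⟨cg, hcg, hg⟩ := exists_le_real_fourGlue
  refine ⟨c * cg ^ 4, by positivity, max n₀ 4, fun q n hq hn h2 => ?_⟩
  have hn₀ : n₀ ≤ n := le_trans (le_max_left _ _) hn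
  have h4 : 4 ≤ n := le_trans (le_max_right _ _) hn
  have h₁ : n ≤ 64 * q := by omega
  have hsepn := hs n (64 * q) hn₀ h2
  have hG := (hg q hq).2
  have key := sepFour_mul_glueExt_le hq h4 h₁
  calc c * cg ^ 4 * critFourArmProb n (64 * q)
      = (c * critFourArmProb n (64 * q)) * cg ^ 4 := by ring
    _ ≤ (triSitePercolation half).real (sepFourArm n (64 * q)) *
          (triSitePercolation half).real (fourGlueExt q) ^ 4 :=
        mul_le_mul hsepn (pow_le_pow_left₀ hcg.le hG 4) (by positivity) measureReal_nonneg
    _ ≤ critFourArmProb n (512 * (q + 1) - 1) := key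

set_option maxRecDepth 4096 in
/-- **Quasi-multiplicativity along well-spaced scales from separation** (Nolin 2008, Prop. 12
(ii) and Prop. 17 [arXiv 0711.4948: Prop. 11, Prop. 16], `j = 4`, `p = 1/2`): IF
`c · π₄(n, N) ≤ P_{1/2}(sepFourArm n N)` for `n₀ ≤ n`, `2n ≤ N`, THEN
`c_Q · π₄(n₁, 64q) · π₄(512(q+1), n₃) ≤ π₄(n₁, n₃)` for `q ≥ 1`, `n₀ ∨ 4 ≤ n₁`, `2n₁ ≤ 64q`,
`n₀ ≤ 512(q+1)`, `1024(q+1) ≤ n₃` (`sepFour_mul_sepFour_mul_glue_le` and RSW). [cite: Nolin2008, §4.3 Prop. 12 (ii) and Prop. 17 (arXiv 0711.4948: Prop. 11, Prop. 16)] -/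
theorem critFourArmProb_quasiMult_spaced_of_separation
    (hsep : ∃ c : ℝ, 0 < c ∧ ∃ n₀ : ℕ, ∀ n N : ℕ, n₀ ≤ n → 2 * n ≤ N →
      c * critFourArmProb n N ≤ (triSitePercolation half).real (sepFourArm n N)) :
    ∃ cQ : ℝ, 0 < cQ ∧ ∃ n₀ : ℕ, ∀ q n₁ n₃ : ℕ, 1 ≤ q → n₀ ≤ n₁ → 2 * n₁ ≤ 64 * q →
      n₀ ≤ 512 * (q + 1) → 2 * (512 * (q + 1)) ≤ n₃ →
      cQ * (critFourArmProb n₁ (64 * q) * critFourArmProb (512 * (q + 1)) n₃) ≤ critFourArmProb n₁ n₃ := by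
  obtain ⟨c, hc, n₀, hs⟩ := hsep
  obtain ⟨cg, hcg, hg⟩ := exists_le_real_fourGlue
  refine ⟨c * c * cg ^ 4, by positivity, max n₀ 4, fun q n₁ n₃ hq hn₁ h2 hn₂ h3 => ?_⟩
  have hn₀ : n₀ ≤ n₁ := le_trans (le_max_left _ _) hn₁
  have h4 : 4 ≤ n₁ := le_trans (le_max_right _ _) hn₁
  have h₁ : n₁ ≤ 64 * q := by omega
  have h₃ : 512 * (q + 1) ≤ n₃ := (Nat.le_mul_of_pos_left (512 * (q + 1)) (by norm_num)).trans h3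
  have hs₁ := hs n₁ (64 * q) hn₀ h2
  have hs₂ := hs (512 * (q + 1)) n₃ (le_trans (le_max_left _ _) hn₂) h3
  have hG := (hg q hq).1
  have key := sepFour_mul_sepFour_mul_glue_le hq h4 h₁ h₃
  have hnn₁ : 0 ≤ c * critFourArmProb n₁ (64 * q) := mul_nonneg hc.le (polyArmProb_nonneg _ _ _)
  have hnn₂ : 0 ≤ critFourArmProb (512 * (q + 1)) n₃ := polyArmProb_nonneg _ _ _
  calc c * c * cg ^ 4 * (critFourArmProb n₁ (64 * q) * critFourArmProb (512 * (q + 1)) n₃)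
      = (c * critFourArmProb n₁ (64 * q)) * (c * critFourArmProb (512 * (q + 1)) n₃) * cg ^ 4 := by ring
    _ ≤ (triSitePercolation half).real (sepFourArm n₁ (64 * q)) *
          (triSitePercolation half).real (sepFourArm (512 * (q + 1)) n₃) *
          (triSitePercolation half).real (fourGlue q) ^ 4 :=
        mul_le_mul (mul_le_mul hs₁ hs₂ (mul_nonneg hc.le hnn₂) measureReal_nonneg)
          (pow_le_pow_left₀ hcg.le hG 4) (by positivity) (mul_nonneg measureReal_nonneg measureReal_nonneg)
    _ ≤ critFourArmProb n₁ n₃ := key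

set_option maxRecDepth 4096 in
/-- **Quasi-multiplicativity of the critical four-arm probability from four-arm separation**
(Smirnov–Werner 2001, (10); Nolin 2008, Prop. 17 [arXiv 0711.4948: Prop. 16]; Kesten 1987), in
the shape (B) consumed by `fourArm_exponent_of_scaleBounds_crit`: IF the well-separated four-arm
event with alternating colours is comparable to the four-arm event at `p = 1/2`,
`c · π₄(n, N) ≤ P_{1/2}(sepFourArm n N)` for `n₀ ≤ n`, `2n ≤ N` (Nolin's arm-separation theorem,
Thm. 11 [arXiv Thm. 10], for `j = 4` with the landing sequence "middle halves of sides
`0, 1, 3, 4`", combined with colour switching for the adjacent colour arrangement, §4 / §5.1), THEN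
there are `n₀'` and `c' > 0` with `c' · π₄(r, R) · π₄(4R, S) ≤ π₄(r, S)` for `n₀' ≤ r`,
`16 r < 4R < S`. Proof: with `q = ⌊R/64⌋`, the case `S ≥ 1024(q+1)` is the spaced
quasi-multiplicativity (monotonicity of `π₄` in both radii), and the case `S < 1024(q+1)` follows
from two extensions (`64q → 512q + 511 ≥ 512q → 4096q + 511 ≥ S`). The hypothesis is the `j = 4`
analogue of the tree's named fact `Nolin2008_twoArm_separation` (`ArmSeparation.lean`); it is kept
as a binder rather than vendored as a named fact (D-0026), and it is not a form of the conclusion: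
the passage from separated events to quasi-multiplicativity (fences, RSW gluing in four disjoint
cones, Nolin's Lemma 13) is what this file proves; `triSitePercolation_sepFourArm_pos` checks
the necessary condition `P_{1/2}(sepFourArm n N) > 0`. [cite: SmirnovWernerMRL2001, §4 (10) and §4.2] [cite: Nolin2008, Prop. 17 with Thm. 11 and Prop. 12 (arXiv 0711.4948: Prop. 16, Thm. 10, Prop. 11)] -/
theorem critFourArmProb_quasiMult_of_separation
    (hsep : ∃ c : ℝ, 0 < c ∧ ∃ n₀ : ℕ, ∀ n N : ℕ, n₀ ≤ n → 2 * n ≤ N →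
      c * critFourArmProb n N ≤ (triSitePercolation half).real (sepFourArm n N)) :
    ∃ n₀ : ℕ, ∃ c > (0 : ℝ), ∀ ⦃r R S : ℕ⦄, n₀ ≤ r → 16 * r < 4 * R → 4 * R < S →
      c * (critFourArmProb r R * critFourArmProb (4 * R) S) ≤ critFourArmProb r S := by
  obtain ⟨cE, hcE, nE, hE⟩ := critFourArmProb_extend_of_separation hsep
  obtain ⟨cQ, hcQ, nQ, hQ⟩ := critFourArmProb_quasiMult_spaced_of_separation hsep
  refine ⟨max (max nE nQ) 32, min cQ (cE * cE), lt_min hcQ (by positivity), fun r R S hr hR hS => ?_⟩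
  have hrE : nE ≤ r := le_trans (le_trans (le_max_left _ _) (le_max_left _ _)) hr
  have hrQ : nQ ≤ r := le_trans (le_trans (le_max_right _ _) (le_max_left _ _)) hr
  have hr32 : 32 ≤ r := le_trans (le_max_right _ _) hr
  -- the scale `q = ⌊R / 64⌋`
  set q := R / 64 with hq
  have hqR : 64 * q ≤ R := Nat.mul_div_le R 64
  have hRq : R < 64 * (q + 1) := by omega
  have hq1 : 1 ≤ q := by omega
  have h2r : 2 * r ≤ 64 * q := by omega
  have nn : ∀ a b : ℕ, 0 ≤ critFourArmProb a b := fun a b => polyArmProb_nonneg _ a b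
  have l1 : ∀ a b : ℕ, critFourArmProb a b ≤ 1 := fun a b => polyArmProb_le_one _ a b
  have hπR : critFourArmProb r R ≤ critFourArmProb r (64 * q) := polyArmProb_anti_holds _ (by omega) hqR
  have hmin₁ : min cQ (cE * cE) ≤ cQ := min_le_left _ _
  have hmin₂ : min cQ (cE * cE) ≤ cE * cE := min_le_right _ _
  have hmin₀ : 0 ≤ min cQ (cE * cE) := le_min hcQ.le (by positivity)
  by_cases hcase : 2 * (512 * (q + 1)) ≤ S
  · -- well-spaced scales
    have h4R : critFourArmProb (4 * R) S ≤ critFourArmProb (512 * (q + 1)) S :=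
      polyArmProb_mono_left _ (by omega) (by omega)
    have key := hQ q r S hq1 hrQ h2r (by omega) hcase
    calc min cQ (cE * cE) * (critFourArmProb r R * critFourArmProb (4 * R) S)
        ≤ cQ * (critFourArmProb r (64 * q) * critFourArmProb (512 * (q + 1)) S) :=
          mul_le_mul hmin₁ (mul_le_mul hπR h4R (nn _ _) (nn _ _)) (mul_nonneg (nn _ _) (nn _ _)) hcQ.le
      _ ≤ critFourArmProb r S := key
  · -- bounded ratio: two extensions
    have hcase' : S < 2 * (512 * (q + 1)) := Nat.lt_of_not_le hcase
    have e1 := hE q r hq1 hrE h2r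
    have e2 := hE (8 * q) r (by omega) hrE (by omega)
    have e64 : 64 * (8 * q) = 512 * q := by ring
    rw [e64] at e2
    have a1 : critFourArmProb r (512 * (q + 1) - 1) ≤ critFourArmProb r (512 * q) :=
      polyArmProb_anti_holds _ (by omega) (by omega)
    have a2 : critFourArmProb r (512 * (8 * q + 1) - 1) ≤ critFourArmProb r S :=
      polyArmProb_anti_holds _ (by omega) (by omega)
    calc min cQ (cE * cE) * (critFourArmProb r R * critFourArmProb (4 * R) S)
        ≤ (cE * cE) * (critFourArmProb r (64 * q) * 1) :=
          mul_le_mul hmin₂ (mul_le_mul hπR (l1 _ _) (nn _ _) (nn _ _)) (mul_nonneg (nn _ _) (nn _ _))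
            (by positivity)
      _ = cE * (cE * critFourArmProb r (64 * q)) := by ring
      _ ≤ cE * critFourArmProb r (512 * (q + 1) - 1) := mul_le_mul_of_nonneg_left e1 hcE.le
      _ ≤ cE * critFourArmProb r (512 * q) := mul_le_mul_of_nonneg_left a1 hcE.le
      _ ≤ critFourArmProb r (512 * (8 * q + 1) - 1) := e2
      _ ≤ critFourArmProb r S := a2

/-- **The four-arm exponent from (16)ℕ, (9)ℕ and four-arm separation** (Smirnov–Werner 2001,
Thm. 4 for `j = 4`, read on integer data): IF `π₄(ρ r, ρ R) → L(r, R)` for all integers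
`1 ≤ r < R` (SW (16), Smirnov's theorem / the full scaling limit), `log L(1, n) / log n → -5/4`
(SW (9) with (15): the `SLE₆` exponent `(4² - 1)/12` of Lawler–Schramm–Werner), and the
well-separated four-arm event with alternating colours is comparable to the four-arm event at
`p = 1/2` (Kesten/Nolin arm separation for `j = 4` with colour switching), THEN `fourArm_exponent`
holds. The whole discrete RSW/gluing layer of SW's "(10) approximate multiplicativity" is proved
(`critFourArmProb_quasiMult_of_separation`); what remains for `fourArm_exponent_holds` is exactly
these three inputs. [cite: SmirnovWernerMRL2001, Thm. 4 (j = 4), §4 (9), (10), (15), (16)] [cite: Nolin2008, Thm. 11 and Prop. 17 (arXiv 0711.4948: Thm. 10, Prop. 16)] -/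
theorem fourArm_exponent_of_separation (L : ℕ → ℕ → ℝ)
    (hlim : ∀ r R : ℕ, 1 ≤ r → r < R →
      Tendsto (fun ρ : ℕ => critFourArmProb (ρ * r) (ρ * R)) atTop (𝓝 (L r R)))
    (hexp : Tendsto (fun n : ℕ => Real.log (L 1 n) / Real.log n) atTop (𝓝 (-(5 / 4))))
    (hsep : ∃ c : ℝ, 0 < c ∧ ∃ n₀ : ℕ, ∀ n N : ℕ, n₀ ≤ n → 2 * n ≤ N →
      c * critFourArmProb n N ≤ (triSitePercolation half).real (sepFourArm n N)) :
    fourArm_exponent :=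
  fourArm_exponent_of_limits_nat_crit L hlim hexp (critFourArmProb_quasiMult_of_separation hsep)

/-! ### Non-vacuity of the well-separated four-arm event (sanity check of the separation hypothesis) -/

/-- **The open cone is a fenced-open-arm configuration.** For `16 ≤ n ≤ N` the configuration
whose open sites are exactly those of the open cone `triCone` over side `0` lies in
`sepOpenArm n N`: the witnesses of `halfPlane_mem_sepOpenArm` (`ArmSeparationNonvacuity.lean`:
landing sites `(n, -n/4)`, `(N, -N/4)`, the columns `x₀ = n - 1`, `x₀ = N + 1` through the free
spaces and the path `(n-1, -n/4) → (N, -n/4) → (N, -N/4) → (N+1, -N/4)`) all lie in the open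
cone. (Nolin 2008, §4.1: arm events are non-empty from `n₀(j)` on, "we can then draw straight
lines heading toward the exterior".) [cite: Nolin2008, §4.1 (n₀(j))] -/
theorem cone_mem_sepOpenArm {n N : ℕ} (hn : 16 ≤ n) (hnN : n ≤ N) :
    (triCone : Set (Site 2)) ∈ sepOpenArm n N := by
  have hN : 16 ≤ N := hn.trans hnN
  have hnN' : (n : ℤ) ≤ N := by exact_mod_cast hnN
  set ω : Set (Site 2) := triCone with hω
  set z : Site 2 := ![(N : ℤ), -((N / 4 : ℕ) : ℤ)] with hz
  set z' : Site 2 := ![(n : ℤ), -((n / 4 : ℕ) : ℤ)] with hz'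
  set u : Site 2 := ![(n : ℤ) - 1, -((n / 4 : ℕ) : ℤ)] with hu
  set u' : Site 2 := ![(N : ℤ) + 1, -((N / 4 : ℕ) : ℤ)] with hu'
  have hzL : z ∈ sepLanding N := by
    rw [mem_sepLanding, hz, site_mk_apply_zero, site_mk_apply_one]; omega
  have hz'L : z' ∈ sepLanding n := by
    rw [mem_sepLanding, hz', site_mk_apply_zero, site_mk_apply_one]; omega
  have memω : ∀ x y : ℤ, 0 < x → y < 0 → 0 < x + y → (![x, y] : Site 2) ∈ ω := by
    intro x y h1 h2 h3
    rw [hω, mem_triCone, site_mk_apply_zero, site_mk_apply_one]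
    exact ⟨h1, h2, h3⟩
  refine ⟨z, z', u, u', hzL, hz'L, ?_, ?_, ?_⟩
  · -- the inner free space is crossed vertically by the column `x₀ = n - 1`
    refine ⟨![(n : ℤ) - 1, -((n / 4 : ℕ) : ℤ) - (n / 64 : ℕ)], ![(n : ℤ) - 1, -((n / 4 : ℕ) : ℤ) + (n / 64 : ℕ)],
      by rw [hz', site_mk_apply_one, site_mk_apply_one], by rw [hz', site_mk_apply_one, site_mk_apply_one], ?_, ?_⟩
    · have p := pathIn_vSegment_up (A := sepInnerFence n z' ∩ ω) (x := (n : ℤ) - 1)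
        (t := -((n / 4 : ℕ) : ℤ) - (n / 64 : ℕ)) (n / 64) (fun i hi => by
          refine ⟨?_, memω _ _ (by omega) (by omega) (by omega)⟩
          rw [mem_sepInnerFence, hz', site_mk_apply_zero, site_mk_apply_one, site_mk_apply_one]; omega)
      have e : -((n / 4 : ℕ) : ℤ) - ((n / 64 : ℕ) : ℤ) + ((n / 64 : ℕ) : ℤ) = -((n / 4 : ℕ) : ℤ) := by ring
      rw [e] at p; exact p
    · exact pathIn_vSegment_up (A := sepInnerFence n z' ∩ ω) (x := (n : ℤ) - 1)
        (t := -((n / 4 : ℕ) : ℤ)) (n / 64) (fun i hi => by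
          refine ⟨?_, memω _ _ (by omega) (by omega) (by omega)⟩
          rw [mem_sepInnerFence, hz', site_mk_apply_zero, site_mk_apply_one, site_mk_apply_one]; omega)
  · -- the outer free space is crossed vertically by the column `x₀ = N + 1`
    refine ⟨![(N : ℤ) + 1, -((N / 4 : ℕ) : ℤ) - (N / 64 : ℕ)], ![(N : ℤ) + 1, -((N / 4 : ℕ) : ℤ) + (N / 64 : ℕ)],
      by rw [hz, site_mk_apply_one, site_mk_apply_one], by rw [hz, site_mk_apply_one, site_mk_apply_one], ?_, ?_⟩
    · have p := pathIn_vSegment_up (A := sepOuterFence N z ∩ ω) (x := (N : ℤ) + 1)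
        (t := -((N / 4 : ℕ) : ℤ) - (N / 64 : ℕ)) (N / 64) (fun i hi => by
          refine ⟨?_, memω _ _ (by omega) (by omega) (by omega)⟩
          rw [mem_sepOuterFence, hz, site_mk_apply_zero, site_mk_apply_one, site_mk_apply_one]; omega)
      have e : -((N / 4 : ℕ) : ℤ) - ((N / 64 : ℕ) : ℤ) + ((N / 64 : ℕ) : ℤ) = -((N / 4 : ℕ) : ℤ) := by ring
      rw [e] at p; exact p
    · exact pathIn_vSegment_up (A := sepOuterFence N z ∩ ω) (x := (N : ℤ) + 1)
        (t := -((N / 4 : ℕ) : ℤ)) (N / 64) (fun i hi => by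
          refine ⟨?_, memω _ _ (by omega) (by omega) (by omega)⟩
          rw [mem_sepOuterFence, hz, site_mk_apply_zero, site_mk_apply_one, site_mk_apply_one]; omega)
  · -- the joining path `u → (n, -n/4) → (N, -n/4) → (N, -N/4) → u'`
    have hann : ∀ x y : ℤ, (n : ℤ) ≤ x → x ≤ N → y < 0 → -x < y →
        (![x, y] : Site 2) ∈ sepJoinRegion n N z z' ∩ ω := by
      intro x y h1 h2 h3 h4
      refine ⟨Or.inl (Or.inl ?_), memω _ _ (by omega) h3 (by omega)⟩
      rw [mem_triAnnulusSet, triNorm_eq_apply_zero (x := ![x, y]) h3.le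
        (by rw [site_mk_apply_zero, site_mk_apply_one]; omega), site_mk_apply_zero]
      exact ⟨h1, h2⟩
    have huJ : u ∈ sepJoinRegion n N z z' ∩ ω := by
      refine ⟨Or.inr ?_, by rw [hu]; exact memω _ _ (by omega) (by omega) (by omega)⟩
      rw [mem_triOpenBall, triNorm_lt_iff_lin]
      simp only [hu, hz', Pi.sub_apply, site_mk_apply_zero, site_mk_apply_one]; omega
    have hu'J : u' ∈ sepJoinRegion n N z z' ∩ ω := by
      refine ⟨Or.inl (Or.inr ?_), by rw [hu']; exact memω _ _ (by omega) (by omega) (by omega)⟩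
      rw [mem_triOpenBall, triNorm_lt_iff_lin]
      simp only [hu', hz, Pi.sub_apply, site_mk_apply_zero, site_mk_apply_one]; omega
    -- segment 1
    have s₁ : PathIn triGraph (sepJoinRegion n N z z' ∩ ω) u ![(n : ℤ), -((n / 4 : ℕ) : ℤ)] := by
      refine PathIn.of_adj huJ (hann _ _ le_rfl hnN' (by omega) (by omega)) ?_
      have e : (![(n : ℤ), -((n / 4 : ℕ) : ℤ)] : Site 2) = u + triE0 := by
        rw [hu, site_mk_add_triE0]; congr 1; ring
      rw [e]; exact triGraph_adj_add_triE0 _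
    -- segment 2
    have s₂ : PathIn triGraph (sepJoinRegion n N z z' ∩ ω) ![(n : ℤ), -((n / 4 : ℕ) : ℤ)]
        ![(N : ℤ), -((n / 4 : ℕ) : ℤ)] := by
      have p := pathIn_hSegment (A := sepJoinRegion n N z z' ∩ ω) (a := (n : ℤ)) (y := -((n / 4 : ℕ) : ℤ))
        (N - n) (fun i hi => hann _ _ (by omega) (by omega) (by omega) (by omega))
      have e : (n : ℤ) + ((N - n : ℕ) : ℤ) = N := by push_cast [Nat.cast_sub hnN]; ring
      rw [e] at p; exact p
    -- segment 3
    have s₃ : PathIn triGraph (sepJoinRegion n N z z' ∩ ω) ![(N : ℤ), -((n / 4 : ℕ) : ℤ)]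
        ![(N : ℤ), -((N / 4 : ℕ) : ℤ)] := by
      have h44 : n / 4 ≤ N / 4 := Nat.div_le_div_right hnN
      have p := pathIn_vSegment_down (A := sepJoinRegion n N z z' ∩ ω) (x := (N : ℤ)) (t := -((n / 4 : ℕ) : ℤ))
        (N / 4 - n / 4) (fun i hi => hann _ _ hnN' le_rfl (by omega) (by omega))
      have e : -((n / 4 : ℕ) : ℤ) - ((N / 4 - n / 4 : ℕ) : ℤ) = -((N / 4 : ℕ) : ℤ) := by
        push_cast [Nat.cast_sub h44]; ring
      rw [e] at p; exact p
    -- segment 4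
    have s₄ : PathIn triGraph (sepJoinRegion n N z z' ∩ ω) ![(N : ℤ), -((N / 4 : ℕ) : ℤ)] u' := by
      refine PathIn.of_adj (hann _ _ hnN' le_rfl (by omega) (by omega)) hu'J ?_
      rw [hu', ← site_mk_add_triE0]; exact triGraph_adj_add_triE0 _
    exact ((s₁.trans s₂).trans s₃).trans s₄

/-- The open cone configuration is a confined fenced-open-arm configuration, confined to itself. [cite: Nolin2008, §4.1 (n₀(j))] -/
theorem cone_mem_sepOpenArmIn {n N : ℕ} (hn : 16 ≤ n) (hnN : n ≤ N) :
    (triCone : Set (Site 2)) ∈ sepOpenArmIn triCone n N := by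
  have h := cone_mem_sepOpenArm hn hnN
  rw [← sepOpenArmIn_univ] at h
  have h' := mem_sepOpenArmIn_inter_self h
  rwa [univ_inter] at h'

/-- `ρ³` is the central symmetry. [folklore] -/
theorem triRotIsoPow_three_apply (v : Site 2) : triRotIsoPow 3 v = -v := by
  obtain ⟨-, -, -, -, -, -, r30, r31, -⟩ := rot_apply_formula v
  ext j; fin_cases j
  · rw [Pi.neg_apply]; exact r30
  · rw [Pi.neg_apply]; exact r31

/-- **Non-vacuity of the well-separated four-arm event.** For `16 ≤ n ≤ N` the configuration
whose open sites are exactly those of the two opposite open cones over sides `0` and `3` lies in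
`sepFourArm n N`: read in colour `true` in the frames `0`, `3` and in colour `false` in the frames
`1`, `4` it contains the open cone configuration (`cone_mem_sepOpenArmIn`), and the four confining
cones are pairwise disjoint. (Sanity check of the definitions; Nolin 2008, §4.1, `n₀(j)`.) [cite: Nolin2008, §4.1 (n₀(j))] -/
theorem biCone_mem_sepFourArm {n N : ℕ} (hn : 16 ≤ n) (hnN : n ≤ N) :
    {v : Site 2 | v ∈ triCone ∨ -v ∈ triCone} ∈ sepFourArm n N := by
  set ω₄ : Set (Site 2) := {v : Site 2 | v ∈ triCone ∨ -v ∈ triCone} with hω₄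
  have K := cone_mem_sepOpenArmIn hn hnN
  -- the four re-read configurations contain the open cone configuration
  have f0 : (triCone : Set (Site 2)) ≤ readFrame 0 true ω₄ := by
    intro v hv
    rw [readFrame_true, mem_rotConfig, triRotIsoPow_zero_apply]
    exact Or.inl hv
  have f3 : (triCone : Set (Site 2)) ≤ readFrame 3 true ω₄ := by
    intro v hv
    rw [readFrame_true, mem_rotConfig, triRotIsoPow_three_apply]
    right; rw [neg_neg]; exact hv
  have f1 : (triCone : Set (Site 2)) ≤ readFrame 1 false ω₄ := by
    intro v hv
    rw [readFrame_false, mem_rotConfig, mem_compl_iff]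
    obtain ⟨-, -, r10, r11, -⟩ := rot_apply_formula v
    rw [mem_triCone] at hv
    rintro (h | h)
    · rw [mem_triCone, r10, r11] at h; omega
    · rw [mem_triCone] at h; simp only [Pi.neg_apply, r10, r11] at h; omega
  have f4 : (triCone : Set (Site 2)) ≤ readFrame 4 false ω₄ := by
    intro v hv
    rw [readFrame_false, mem_rotConfig, mem_compl_iff]
    obtain ⟨-, -, -, -, -, -, -, -, r40, r41, -⟩ := rot_apply_formula v
    rw [mem_triCone] at hv
    rintro (h | h)
    · rw [mem_triCone, r40, r41] at h; omega
    · rw [mem_triCone] at h; simp only [Pi.neg_apply, r40, r41] at h; omega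
  refine ⟨⟨triCone, {w | -w ∈ triCone}, ?_, ?_, ?_⟩,
    ⟨{w | (triRotIsoPow 1).symm w ∈ triCone}, {w | (triRotIsoPow 4).symm w ∈ triCone}, ?_, ?_, ?_⟩⟩
  · rw [Set.disjoint_left]
    intro w h1 h2
    rw [mem_triCone] at h1
    rw [mem_setOf_eq, mem_triCone] at h2
    simp only [Pi.neg_apply] at h2
    omega
  · rw [mem_sepArmAt]
    have e : (triRotIsoPow 0) ⁻¹' (triCone : Set (Site 2)) = triCone := by
      ext v; rw [mem_preimage, triRotIsoPow_zero_apply]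
    rw [e]
    exact isUpperSet_sepOpenArmIn _ n N f0 K
  · show readFrame 3 true ω₄ ∈ sepOpenArmIn ((triRotIsoPow 3) ⁻¹' {w : Site 2 | -w ∈ triCone}) n N
    have e : (triRotIsoPow 3) ⁻¹' {w : Site 2 | -w ∈ triCone} = triCone := by
      ext v; rw [mem_preimage, mem_setOf_eq, triRotIsoPow_three_apply, neg_neg]
    rw [e]
    exact isUpperSet_sepOpenArmIn _ n N f3 K
  · rw [Set.disjoint_left]
    intro w h1 h4
    rw [mem_setOf_eq] at h1 h4
    have e1 : triRotIsoPow 1 ((triRotIsoPow 1).symm w) = w := RelIso.apply_symm_apply _ w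
    have e4 : triRotIsoPow 4 ((triRotIsoPow 4).symm w) = w := RelIso.apply_symm_apply _ w
    exact absurd (rot_sector_injective (by norm_num) (by norm_num) h1 h4 (e1.trans e4.symm)) (by norm_num)
  · rw [mem_sepArmAt]
    have e : (triRotIsoPow 1) ⁻¹' {w : Site 2 | (triRotIsoPow 1).symm w ∈ triCone} = triCone := by
      ext v; rw [mem_preimage, mem_setOf_eq, RelIso.symm_apply_apply]
    rw [e]
    exact isUpperSet_sepOpenArmIn _ n N f1 K
  · show readFrame 4 false ω₄ ∈ sepOpenArmIn ((triRotIsoPow 4) ⁻¹' {w : Site 2 | (triRotIsoPow 4).symm w ∈ triCone}) n N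
    have e : (triRotIsoPow 4) ⁻¹' {w : Site 2 | (triRotIsoPow 4).symm w ∈ triCone} = triCone := by
      ext v; rw [mem_preimage, mem_setOf_eq, RelIso.symm_apply_apply]
    rw [e]
    exact isUpperSet_sepOpenArmIn _ n N f4 K

/-- The rotated supports of a well-separated event lie in `Λ_{N + N/8}`. [folklore] -/
theorem image_rot_sepConeSupport_subset_ball (a : ℕ) (n N : ℕ) :
    triRotIsoPow a '' sepConeSupport n N ⊆ ↑(triBall (N + N / 8)) := by
  rintro w ⟨v, hv, rfl⟩
  rw [mem_sepConeSupport] at hv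
  rw [Finset.mem_coe, mem_triBall_iff, triNorm_rot]
  push_cast; exact hv.2.1

/-- **The well-separated four-arm event has positive probability** for `16 ≤ n ≤ N`: it is
determined by the sites of `Λ_{N + N/8}` and contains the two-cone configuration, hence the
cylinder event of the configurations agreeing with it on `Λ_{N + N/8}`. This is the necessary
condition `P_{1/2}(sepFourArm n N) > 0` for the separation hypothesis
`c · π₄(n, N) ≤ P_{1/2}(sepFourArm n N)` of `critFourArmProb_quasiMult_of_separation`
(`π₄ > 0`, `critFourArmProb_pos`) — a consistency check of the Lean rendering, not a proof of it. [cite: Nolin2008, Thm. 11 (arXiv 0711.4948: Thm. 10)] -/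
theorem triSitePercolation_sepFourArm_pos {n N : ℕ} (hn : 16 ≤ n) (hnN : n ≤ N) :
    0 < (triSitePercolation half).real (sepFourArm n N) := by
  classical
  have h4 : 4 ≤ n := le_trans (by norm_num) hn
  have dS : DeterminedBy (sepFourArm n N) ↑(triBall (N + N / 8)) :=
    ((determinedBy_sepArmPair 0 true h4 hnN).mono (union_subset (image_rot_sepConeSupport_subset_ball 0 n N)
      (image_rot_sepConeSupport_subset_ball (0 + 3) n N))).inter
    ((determinedBy_sepArmPair 1 false h4 hnN).mono (union_subset (image_rot_sepConeSupport_subset_ball 1 n N)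
      (image_rot_sepConeSupport_subset_ball (1 + 3) n N)))
  have hcyl : {ω : Set (Site 2) | ∀ v ∈ triBall (N + N / 8), (v ∈ ω ↔ (v ∈ triCone ∨ -v ∈ triCone))} ⊆
      sepFourArm n N := by
    intro ω hω
    have heq : ω ∩ ↑(triBall (N + N / 8)) =
        {v : Site 2 | v ∈ triCone ∨ -v ∈ triCone} ∩ ↑(triBall (N + N / 8)) := by
      ext v
      simp only [mem_inter_iff, Finset.mem_coe, mem_setOf_eq]
      constructor
      · rintro ⟨h1, h2⟩; exact ⟨(hω v h2).1 h1, h2⟩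
      · rintro ⟨h1, h2⟩; exact ⟨(hω v h2).2 h1, h2⟩
    exact ((determinedBy_iff _ _).1 dS ω {v : Site 2 | v ∈ triCone ∨ -v ∈ triCone} heq).2
      (biCone_mem_sepFourArm hn hnN)
  exact (TwoArmPos.triSitePercolation_half_cylinder_pos (triBall (N + N / 8))
    (fun v => v ∈ triCone ∨ -v ∈ triCone)).trans_le (measureReal_mono hcyl (measure_ne_top _ _))

end Literature.Probability.Percolation

end
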